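import Summits.CriticalPhenomena.PercolationContinuityZ3.Theorems.Transplant.CayleyScaledCentralCustomers
import HarnessLib

/-!
# SHARPNESS ROW 90 (P5-SHARPNESS §56.5): **the simplest graph the scaled rung U_s reaches and no closed node does** — `G₂₃ = Cay(ℤ²; ±e₂, ±2e₁, ±3e₁)`,
# the square lattice with its horizontal bonds replaced by bonds of length 2 and 3

builds on p205010 (kernel theorem, internal audit signed; external expert review pending) — nothing in this file uses p205010.  Lane `prim-bschramm`, seat
`prim-bschramm-p5` gen 25 (refuter / sharpness search; class B, `--supports stmt-CriticalPhenomena-4575 --as helper`).  Def-free apart from the generating set `S₂₃`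
(a `Finset`, data); no node / statement / `@[conjecture]`; NOTHING about the OPEN nodes U (`SamePDropOfSkeletonFrmFrom₁`) / U_s (`SamePDropOfSkeletonFrmScaled₁`) is claimed —
§1 is CONDITIONAL on U_s (hypothesis `hN`).
* §1 `G₂₃` is a U_s CUSTOMER: `S₂₃` generates `ℤ²` (`closure_S₂₃`), so «CayleyScaledCentralCustomers» `ZdGens.criticalContinuity_of_frmScaledNode₁` gives `θ_v(p_c) = 0` at every
  vertex MODULO `SamePDropOfSkeletonFrmScaled₁` (`G₂₃.criticalContinuity_of_frmScaledNode₁`).  (Its scaled chart: `φ = (x, 3y)`, `L = N = 3`; the coarse chart `⌊φ/3⌋` has THREE residue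
  types — so the (D-s2‴) proxies are genuinely exercised, `D = 2`.)
* §2 `G₂₃` is NOT a customer of the closed one-type / point-symmetric nodes through their natural device: **no chart `ψ : ℤ² → ℤ²` that is point-symmetric about every vertex
  (`ψ (2a − w) = 2ψ a − ψ w`, the `neg` field of `PlanarSkeletonNeg`/`Sign`/`Conc` realised by the group inversions `w ↦ 2a − w`, which ARE automorphisms of every abelian Cayley
  graph) is 1-Lipschitz along `S₂₃` with UNIT steps** (`no_pointSymmetric_unitStep_chart`): two inversions compose to the translation by `2e₁`, along which `ψ` moves by the EVEN
  vector `2(ψ e₁ − ψ 0)` of sup-norm `≤ 1` (the bond `2e₁`), hence not at all; so the four horizontal neighbours `w ± 2e₁, w ± 3e₁` carry at most ONE `ψ`-value other than `ψ w`,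
  the two vertical ones two more — three values for the FOUR unit-step targets `ψ w ± e₀, ψ w ± e₁`: pigeonhole.
R-level remainder (desk §56.5, not claimed here): the same three lines kill the axis-reflection involutions, and a ONE-type `PlanarSkeletonFrmFrom` (U/N2/N1) chart on `G₂₃` with affine
frames is impossible as well (index-≤-4 translation lattice + walk asymptotics); `Aut(G₂₃)` is expected to be affine (`G₂₃ = Cay(ℤ; ±2, ±3) □ ℤ`, the first factor a skew quotient of the
square grid), which would make `G₂₃` a graph where `θ(p_c) = 0` is reachable ONLY through U_s or the open multi-type nodes; in print it is open (finite range on `ℤ²` without the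
`π/2`-rotation symmetry RSW needs — Köhler-Schindler–Tassion 2020/23 assume all symmetries of `ℤ²`; Kesten 1982 Ch. 3/6 needs a planar matching pair; `G₂₃ ⊇ Cay(ℤ; 2, 3)` is not planar).
[cite: BenjaminiSchramm1996, Conj. 4] [cite: MartineauSevero2019, Cor. 2.2] [cite: GrimmettPercolation1999, §12.1 p. 349 (general lattices)] [this work]
-/

noncomputable section

namespace Summit.CriticalPhenomena.PercolationContinuityZ3.Theorems.Transplant

open SimpleGraph Literature.Probability.LatticeModels Literature.Probability.Percolation
open scoped Classical

namespace G₂₃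

/-! ## §1 The graph and its U_s customer line -/

/-- First basis vector of `ℤ²`. [folklore] -/
abbrev e₁ : Site 2 := Pi.single 0 1
/-- Second basis vector of `ℤ²`. [folklore] -/
abbrev e₂ : Site 2 := Pi.single 1 1

/-- **The generating set `S₂₃ = {±e₂, ±2e₁, ±3e₁}`** of `ℤ²`: vertical bonds of length 1, horizontal bonds of lengths 2 and 3 only. [this work] -/
def S₂₃ : Finset (Site 2) := {e₂, -e₂, 2 • e₁, -(2 • e₁), 3 • e₁, -(3 • e₁)}

/-- Every vector of `ℤ²` is its coordinate combination of `e₁, e₂`. [folklore] -/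
theorem eq_smul_add_smul (v : Site 2) : v = v 0 • e₁ + v 1 • e₂ := by
  ext i; fin_cases i <;> simp [e₁, e₂]

/-- **`S₂₃` generates `ℤ²`** (`e₁ = 3e₁ − 2e₁`). [folklore] -/
theorem closure_S₂₃ : AddSubgroup.closure (S₂₃ : Set (Site 2)) = ⊤ := by
  rw [eq_top_iff]
  intro v _
  have h3 : (3 : ℤ) • e₁ ∈ AddSubgroup.closure (S₂₃ : Set (Site 2)) := AddSubgroup.subset_closure (by simp [S₂₃])
  have h2 : (2 : ℤ) • e₁ ∈ AddSubgroup.closure (S₂₃ : Set (Site 2)) := AddSubgroup.subset_closure (by simp [S₂₃])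
  have he₂ : e₂ ∈ AddSubgroup.closure (S₂₃ : Set (Site 2)) := AddSubgroup.subset_closure (by simp [S₂₃])
  have he₁ : e₁ ∈ AddSubgroup.closure (S₂₃ : Set (Site 2)) := by
    have h := sub_mem h3 h2
    rwa [← sub_smul, show (3 : ℤ) - 2 = 1 by norm_num, one_smul] at h
  rw [eq_smul_add_smul v]
  exact add_mem (AddSubgroup.zsmul_mem _ he₁ _) (AddSubgroup.zsmul_mem _ he₂ _)

/-- **`G₂₃` IS A U_s CUSTOMER**: `θ_v(p_c) = 0` at every vertex of `Cay(ℤ²; S₂₃)` MODULO the scaled node `SamePDropOfSkeletonFrmScaled₁` (OPEN; hypothesis `hN`) —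
the instance `d = 2`, `S = S₂₃` of `ZdGens.criticalContinuity_of_frmScaledNode₁`. [cite: BenjaminiSchramm1996, Conj. 4] [cite: MartineauSevero2019, Cor. 2.2] -/
theorem criticalContinuity_of_frmScaledNode₁ (hN : SamePDropOfSkeletonFrmScaled₁) (v : Site 2) :
    theta (addCayley (S₂₃ : Set (Site 2))) v (criticalProbIOf (addCayley (S₂₃ : Set (Site 2))) v) = 0 :=
  ZdGens.criticalContinuity_of_frmScaledNode₁ le_rfl hN S₂₃ closure_S₂₃ v

/-- The group inversion about `a` is an automorphism of `Cay(ℤ²; S₂₃)` fixing `a` (`S₂₃ = −S₂₃`) — the natural `neg` of a would-be point-symmetric skeleton. [folklore] -/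
def inversion (a : Site 2) : addCayley (S₂₃ : Set (Site 2)) ≃g addCayley (S₂₃ : Set (Site 2)) where
  toEquiv := ⟨fun w => 2 • a - w, fun w => 2 • a - w, fun w => by simp, fun w => by simp⟩
  map_rel_iff' := by
    intro u v
    simp only [Equiv.coe_fn_mk, addCayley_adj]
    constructor
    · rintro ⟨hne, h⟩
      refine ⟨fun huv => hne (by rw [huv]), ?_⟩
      rcases h with h | h
      · right; convert h using 1; abel
      · left; convert h using 1; abel
    · rintro ⟨hne, h⟩
      refine ⟨fun huv => hne (sub_right_injective huv), ?_⟩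
      rcases h with h | h
      · right; convert h using 1; abel
      · left; convert h using 1; abel

/-- The inversion about `a` fixes `a`. [folklore] -/
theorem inversion_apply_self (a : Site 2) : inversion a a = a := by
  show 2 • a - a = a
  rw [two_smul, add_sub_cancel_right]

/-! ## §2 No point-symmetric unit-step 1-Lipschitz chart -/

/-- Two inversions compose to an even translation of the chart: `ψ (w + 2v) = ψ w + 2(ψ v − ψ 0)`. [folklore] -/
theorem apply_add_two_smul {ψ : Site 2 → Site 2} (hsym : ∀ a w, ψ (2 • a - w) = 2 • ψ a - ψ w) (w v : Site 2) :
    ψ (w + 2 • v) = ψ w + 2 • (ψ v - ψ 0) := by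
  have h0 : ψ (-w) = 2 • ψ 0 - ψ w := by
    have h := hsym 0 (-w)
    rw [smul_zero, zero_sub, neg_neg] at h
    rw [h]; abel
  have h1 := hsym v (-w)
  rw [show w + 2 • v = 2 • v - -w by abel, h1, h0]
  abel

/-- **NO POINT-SYMMETRIC UNIT-STEP 1-LIPSCHITZ CHART on `G₂₃`**: a chart `ψ : ℤ² → ℤ²` point-symmetric about EVERY vertex, 1-Lipschitz along the bonds `S₂₃` and with unit steps
in both chart directions at every vertex does not exist. [this work] -/
theorem no_pointSymmetric_unitStep_chart (ψ : Site 2 → Site 2) (hsym : ∀ a w, ψ (2 • a - w) = 2 • ψ a - ψ w)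
    (hlip : ∀ w, ∀ s ∈ S₂₃, ∀ i : Fin 2, |ψ (w + s) i - ψ w i| ≤ 1)
    (hstep : ∀ (w : Site 2) (i : Fin 2) (σ : ℤˣ), ∃ s ∈ S₂₃, ψ (w + s) = ψ w + Pi.single i (σ : ℤ)) : False := by
  -- the translation by 2e₁ does not move ψ
  have hper : ∀ w, ψ (w + 2 • e₁) = ψ w := by
    intro w
    have h := apply_add_two_smul hsym w e₁
    have hz : ψ e₁ - ψ 0 = 0 := by
      ext i
      have hl := hlip w (2 • e₁) (by simp [S₂₃]) i
      rw [h] at hl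
      simp only [Pi.add_apply, Pi.smul_apply, add_sub_cancel_left, Pi.zero_apply] at hl ⊢
      have : |2 * (ψ e₁ - ψ 0) i| ≤ 1 := by simpa using hl
      rw [abs_le] at this
      have h' : (ψ e₁ - ψ 0) i = 0 := by omega
      simpa using h'
    rw [h, hz, smul_zero, add_zero]
  -- hence the four horizontal neighbours carry at most one new value `A := ψ (w + e₁)`
  obtain ⟨w⟩ : Nonempty (Site 2) := ⟨0⟩
  set A := ψ (w + 3 • e₁) with hA
  have h3m : ψ (w + -(3 • e₁)) = A := by
    have h₀ := hper (w + -(3 • e₁)); rw [show w + -(3 • e₁) + 2 • e₁ = w + -(1:ℤ) • e₁ by module] at h₀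
    have h' := hper (w + -(1:ℤ) • e₁); rw [show w + -(1:ℤ) • e₁ + 2 • e₁ = w + (1:ℤ) • e₁ by module] at h'
    have h'' := hper (w + (1:ℤ) • e₁); rw [show w + (1:ℤ) • e₁ + 2 • e₁ = w + 3 • e₁ by module] at h''
    rw [← h₀, ← h', ← h'']
  have h2p : ψ (w + 2 • e₁) = ψ w := hper w
  have h2m : ψ (w + -(2 • e₁)) = ψ w := by
    have h₀ := hper (w + -(2 • e₁)); rw [show w + -(2 • e₁) + 2 • e₁ = w by module] at h₀; exact h₀.symm
  -- every bond image lies in {ψ w, A, B₊, B₋}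
  set T : Finset (Site 2) := {A, ψ (w + e₂), ψ (w + -e₂)} with hT
  have hval : ∀ s ∈ S₂₃, ψ (w + s) ≠ ψ w → ψ (w + s) ∈ T := by
    intro s hs hne
    simp only [S₂₃, Finset.mem_insert, Finset.mem_singleton] at hs
    rcases hs with rfl | rfl | rfl | rfl | rfl | rfl
    · simp [hT]
    · simp [hT]
    · exact absurd h2p hne
    · exact absurd h2m hne
    · rw [← hA]; simp [hT]
    · rw [h3m]; simp [hT]
  -- the four unit-step targets are distinct, nonzero shifts of ψ w, all in T (card ≤ 3): pigeonhole
  set U : Finset (Site 2) := {Pi.single 0 1, Pi.single 0 (-1), Pi.single 1 1, Pi.single 1 (-1)} with hU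
  have hUcard : U.card = 4 := by decide
  have hTcard : T.card ≤ 3 := Finset.card_le_three
  have hmaps : ∀ u ∈ U, ψ w + u ∈ T := by
    intro u hu
    have key : ∀ (i : Fin 2) (σ : ℤˣ), ψ w + Pi.single i (σ : ℤ) ∈ T := by
      intro i σ
      obtain ⟨s, hs, hψ⟩ := hstep w i σ
      rw [← hψ]
      refine hval s hs ?_
      rw [hψ]
      intro h
      have h' := congrFun h i
      simp at h'
    simp only [hU, Finset.mem_insert, Finset.mem_singleton] at hu
    rcases hu with rfl | rfl | rfl | rfl
    · exact key 0 1
    · simpa only [Units.val_neg, Units.val_one] using key 0 (-1)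
    · exact key 1 1
    · simpa only [Units.val_neg, Units.val_one] using key 1 (-1)
  obtain ⟨x, hx, y, hy, hxy, hfxy⟩ := Finset.exists_ne_map_eq_of_card_lt_of_maps_to (by omega : T.card < U.card) hmaps
  exact hxy (add_left_cancel hfxy)

end G₂₃

end Summit.CriticalPhenomena.PercolationContinuityZ3.Theorems.Transplant

end
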